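import Summits.BirchSwinnertonDyer.BirchSwinnertonDyer.Theses.ShadowIsolation
import Summits.BirchSwinnertonDyer.BirchSwinnertonDyer.Theses.SelmerRank
import Summits.BirchSwinnertonDyer.BirchSwinnertonDyer.Theses.Squeeze
import Summits.BirchSwinnertonDyer.BirchSwinnertonDyer.Cruxes.SelmerRankUB.CruxAttackProbes
import Summits.BirchSwinnertonDyer.BirchSwinnertonDyer.Cruxes.SelmerRankUB.Lines.greenberg_split
import Literature.NumberTheory.EllipticCurves.BSDSelmer
import Literature.NumberTheory.EllipticCurves.BSDSelmerCMPConverseKLevelProofs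
import Literature.NumberTheory.EllipticCurves.LeadingTerm

/-!
# Disproof of `SelmerRankUB` (stmt-BirchSwinnertonDyer-0130) — findings

cdisprove seat `refuter-cdisprove-stmt-BirchSwinnertonDyer-0130-0`, cycle 1 (2026-08-17), route
ShadowIsolation (decl shared `rfl`-verbatim with route SelmerRank: `SelmerRankUB`, `SelmerRankUBR2`),
line `greenberg-split` (lead `prover-line-stmt-BirchSwinnertonDyer-0130-0`).

Crux: `∀ W elliptic, globally minimal, p prime, 5 ≤ p → good at p → p ∤ a_p → ρ̄_{E,p} surjective →
corank_{ℤ_p} Sel_{p^∞}(E/ℚ) ≤ ord_{s=1} L(E,s)` (both sides `ℕ`).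

**VERDICT OF THIS CYCLE: NO KILL, and none is possible short of a counterexample to BSD-rank or a
divisible `Ш[p^∞]`** (everything below is kernel-checked, axioms ⊆ {propext, Classical.choice,
Quot.sound}; prose only in docstrings). What was used from earlier crux work: r1's
`CruxAttackProbes` (`ub_iff_rank_add_sha_le`, `ub_everywhere_of_summit_of_shaFinite`,
`rankUB_of_summit`) and the skeleton `Lines/greenberg_split.lean` (`SelmerRankUB_of`,
`noExcessRankBigImage_of_selmerRankUB`), both IMPORTED, not copied.

Index of findings:

* §1 COUNTEREXAMPLE SHAPE `not_selmerRankUB_iff`: `¬ crux ↔ ∃ (W, p)` satisfying the four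
  hypotheses with `r_an < rank + corank Ш[p^∞]` (Greenberg's identity, tree theorem
  `selmerCorank_eq_mordellWeilRank_add_holds`). So a disproof = excess rank (`rank > r_an`) or a
  divisible `Ш[p^∞]` outrunning the analytic rank at a big-image good ordinary prime: the two
  standard conjectures, nothing weaker.
* §2 LOAD-BEARING ANALYSIS. NONE of the hypotheses `5 ≤ p`, `good`, `ordinary`, `surjective`,
  `[IsGloballyMinimal]` is load-bearing for TRUTH: the hypothesis-free strengthening
  `UBEverywhere` is implied by `BirchSwinnertonDyer ∧ SelmerRankShaPFinite` (r1), so NO theorem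
  `selmerRankUB_false_without_<H>` can exist unless BSD-rank or Ш-finiteness fails
  (`no_false_without_of_bsd_shaFinite`). What dropping a hypothesis COSTS is made exact:
  `withoutSurjective_iff` (= crux ∧ the UB-half of the sibling `SelmerRankSmallImage`), and the
  chain `UBEverywhere → UBWithoutSurjective → crux`. The hypotheses are load-bearing only for
  PROVABILITY (Kato 17.4 integrality wants big image; ordinarity for the cyclotomic main-conjecture
  engine).
* §3 PARITY FILTER (modulo the Dokchitser–Dokchitser `p`-parity fact `selmerCorank_mod_two_eq`,
  bsd.S19): a counterexample overshoots by at least TWO — `r_an + 2 ≤ corank_p`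
  (`gap_two_of_parity`). No "off by one" counterexample exists.
* §4 FIRST OPEN CELL (modulo the Gross–Zagier–Kolyvagin fact
  `rank_eq_analyticRank_of_analyticRank_le_one`, bsd.S17): every counterexample has `r_an ≥ 2`
  (`two_le_analyticRank_of_counterexample`), hence with §3 `corank_p ≥ 4`
  (`four_le_selmerCorank_of_counterexample`) and the full profile `counterexample_profile`
  (non-CM, `r_an ≥ 2`, `rank + corank Ш ≥ r_an + 2`, `corank_p ≥ 4`). Cheapest conceivable
  witness: a curve with FOUR independent points, `w = +1`, `L(E,1) = 0` and `L''(E,1) ≠ 0`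
  (certifiable in principle; the numerical scan of the rank-record curves is the `-- Compute`
  block at the end — kit job `j026907`: no witness, `|L^{(j)}(E,1)/j!| < 2·10⁻³⁴` for all
  `j < rank` on every record curve of rank 2–7).
* §5 SCOPE: the hypothesis block binds NO CM curve (tree theorem
  `not_hasCM_of_hasSurjectiveModNGaloisRep_of_five_le`, Serre 1972 §4.5): `selmerRankUB_iff_nonCM`.
  The CM / Eisenstein sectors are the sibling items `SelmerRankCM` / `SelmerRankSmallImage`; the
  negatives-index entry `LeadingTermTamePinch_refuted` (CM congruent-number curves have no
  admissible prime) therefore cannot be replayed against this crux.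
* §6 TIGHTNESS (modulo GZK): the bound is ATTAINED (`corank_p = r_an`) at every instance with
  `r_an ≤ 1` (`tight_of_gzk`), so `≤` cannot be sharpened to `<` and no constant can be shaved;
  the strict strengthening is false as soon as one instance with `r_an = 0` is exhibited
  (`strict_false_of_rankZero_instance` — the instance itself needs a computed central value, not in
  tree: near-miss, see its docstring).
* §7 WHAT THE CRUX GIVES BACK: with the one-sided archimedean input `r_an ≤ rank` (the LB rank-half,
  certified curve-by-curve in every table) the crux IS Ш-cotorsion at big-image good ordinary `p`
  (`shaCotorsion_of_ub_of_noDeficientRank`) — sharpening r1's `shaCotorsion_of_summit_of_ub`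
  (which used the full summit).
* §8 LINE `greenberg-split` (targets = its three stubs; payload `stuck_stubs: []`): no stub is
  refutable — `stub_noExcessRankBigImage ⇐ BirchSwinnertonDyer` (`stub_noExcess_of_bsd`),
  `stub_shaCotorsionBigImage ⇐ SelmerRankShaPFinite` (`stub_sha_of_shaPFinite`),
  `stub_gzkSelmerCell ⇐ GZK fact` (skeleton). Joint sufficiency is the skeleton's kernel-checked
  `SelmerRankUB_of` — no smuggled gap. One SHARPENING for the lead: the GZK stub is image-free and
  prime-free (all `p`, incl. `2, 3`, bad, supersingular, Eisenstein) — more than the composition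
  consumes; the cell it actually needs is `GZKCellBigImage` (crux binders + `r_an ≤ 1`), which the
  crux itself returns, and modulo the Ш-half ALONE the crux is EXACTLY
  `GZKCellBigImage ∧ stub_noExcessRankBigImage` (`selmerRankUB_iff_cells`; the skeleton's
  `selmerRankUB_iff_noExcess` assumed the GZK stub). No stub hypothesis is load-bearing for truth
  (`stub_noExcess_withoutHyps_of_squeezeUB`: dropping all four prime hypotheses and `2 ≤ r_an`
  gives verbatim the sibling item `Squeeze.SqueezeUB`).
* LITERATURE (negative results in print): none — no elliptic curve over a number field with
  `rank > r_an` or with `Ш[p^∞]` of positive corank is known; per-curve the Ш-half is even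
  CERTIFIED for many `(E, p)` of rank ≥ 2 by Kato's divisibility + a `p`-adic `L`-series
  computation (Stein–Wuthrich 2013, "Algorithms for the arithmetic of elliptic curves using
  Iwasawa theory", Math. Comp. 82), while the archimedean half `rank ≤ r_an` is certified for NO
  curve of rank ≥ 4 (exact vanishing of `L''(E,1)` is not decidable numerically).

WHY IT RESISTS (for the provers): the statement is literally `rank + corank Ш[p^∞] ≤ r_an` at the
primes where Kato's Euler system is integral; every hypothesis-mutation stays inside BSD ∧ Ш-finite;
the only refutation route is a certified `L''(E,1) ≠ 0` on a rank-≥ 4 curve (never observed) or a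
theoretical construction of divisible Ш (no mechanism known over number fields).
-/

set_option linter.dupNamespace false

namespace Summit.BirchSwinnertonDyer.BirchSwinnertonDyer.Cruxes.SelmerRankUB.Disproof

open Summit.BirchSwinnertonDyer.BirchSwinnertonDyer.Theses
open Summit.BirchSwinnertonDyer.BirchSwinnertonDyer.Theses.ShadowIsolation (SelmerRankUB)
open Summit.BirchSwinnertonDyer.BirchSwinnertonDyer.Cruxes.SelmerRankUB
open Literature.NumberTheory.EllipticCurves

/-! ## §1 Counterexample shape -/

/-- **What a disproof must produce.** `¬ SelmerRankUB` is EQUIVALENT to the existence of a globally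
minimal elliptic `W/ℚ` and a big-image good ordinary prime `p ≥ 5` with
`r_an < rank E(ℚ) + corank_{ℤ_p} Ш[p^∞]` (Greenberg's identity, tree theorem). [cite: GreenbergLNM1716, §1] -/
theorem not_selmerRankUB_iff :
    ¬ SelmerRankUB ↔
      ∃ (W : WeierstrassCurve ℚ) (_ : W.IsElliptic) (_ : W.IsGloballyMinimal) (p : ℕ)
        (_ : Fact p.Prime), 5 ≤ p ∧ W.HasGoodReductionAtPrime p ∧ ¬ (p : ℤ) ∣ W.frobeniusTrace p ∧
          W.HasSurjectiveModNGaloisRep p ∧ W.analyticRank < W.mordellWeilRank + W.shaCorank p := by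
  constructor
  · intro h
    by_contra hne
    apply h
    intro W _ _ p _ h5 hg ho hs
    by_contra hlt
    apply hne
    refine ⟨W, inferInstance, inferInstance, p, inferInstance, h5, hg, ho, hs, ?_⟩
    have h2 : W.selmerCorank p = W.mordellWeilRank + W.shaCorank p :=
      W.selmerCorank_eq_mordellWeilRank_add_holds p
    omega
  · rintro ⟨W, _, _, p, _, h5, hg, ho, hs, hlt⟩ h
    have h1 := h W p h5 hg ho hs
    have h2 : W.selmerCorank p = W.mordellWeilRank + W.shaCorank p :=
      W.selmerCorank_eq_mordellWeilRank_add_holds p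
    omega

/-- Pointwise dichotomy: at a failing instance either the RANK is excessive (`rank > r_an`, a
counterexample to BSD-rank) or `Ш[p^∞]` has POSITIVE corank (a divisible Ш, a counterexample to the
finiteness of Ш). [cite: GreenbergLNM1716, §1] -/
theorem excessRank_or_divisibleSha_of_failure (W : WeierstrassCurve ℚ) [W.IsElliptic] (p : ℕ)
    [Fact p.Prime] (h : ¬ W.selmerCorank p ≤ W.analyticRank) :
    W.analyticRank < W.mordellWeilRank ∨ 0 < W.shaCorank p := by
  have h2 : W.selmerCorank p = W.mordellWeilRank + W.shaCorank p :=
    W.selmerCorank_eq_mordellWeilRank_add_holds p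
  omega

/-! ## §2 Load-bearing analysis: no hypothesis is load-bearing for truth -/

/-- The crux with the image hypothesis DROPPED (all good ordinary `p ≥ 5`). [folklore] -/
def UBWithoutSurjective : Prop :=
  ∀ (W : WeierstrassCurve ℚ) [W.IsElliptic] [W.IsGloballyMinimal] (p : ℕ) [Fact p.Prime],
    5 ≤ p → W.HasGoodReductionAtPrime p → ¬ (p : ℤ) ∣ W.frobeniusTrace p →
      W.selmerCorank p ≤ W.analyticRank

/-- The crux with the ordinarity hypothesis DROPPED (good, possibly supersingular `p ≥ 5`). [folklore] -/
def UBWithoutOrdinary : Prop :=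
  ∀ (W : WeierstrassCurve ℚ) [W.IsElliptic] [W.IsGloballyMinimal] (p : ℕ) [Fact p.Prime],
    5 ≤ p → W.HasGoodReductionAtPrime p → W.HasSurjectiveModNGaloisRep p →
      W.selmerCorank p ≤ W.analyticRank

/-- The crux with the good-reduction hypothesis DROPPED (`p ∤ a_p` then also allows multiplicative
`p`). [folklore] -/
def UBWithoutGood : Prop :=
  ∀ (W : WeierstrassCurve ℚ) [W.IsElliptic] [W.IsGloballyMinimal] (p : ℕ) [Fact p.Prime],
    5 ≤ p → ¬ (p : ℤ) ∣ W.frobeniusTrace p → W.HasSurjectiveModNGaloisRep p →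
      W.selmerCorank p ≤ W.analyticRank

/-- The crux with `5 ≤ p` DROPPED (`p = 2, 3` allowed). [folklore] -/
def UBWithoutFive : Prop :=
  ∀ (W : WeierstrassCurve ℚ) [W.IsElliptic] [W.IsGloballyMinimal] (p : ℕ) [Fact p.Prime],
    W.HasGoodReductionAtPrime p → ¬ (p : ℤ) ∣ W.frobeniusTrace p →
      W.HasSurjectiveModNGaloisRep p → W.selmerCorank p ≤ W.analyticRank

/-- The crux with EVERY hypothesis dropped, including global minimality: `corank_p Sel ≤ r_an`
for every elliptic `W/ℚ` and every prime `p`. [folklore] -/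
def UBEverywhere : Prop :=
  ∀ (W : WeierstrassCurve ℚ) [W.IsElliptic] (p : ℕ) [Fact p.Prime], W.selmerCorank p ≤ W.analyticRank

theorem withoutSurjective_of_everywhere (h : UBEverywhere) : UBWithoutSurjective :=
  fun W _ _ p _ _ _ _ => h W p

theorem withoutOrdinary_of_everywhere (h : UBEverywhere) : UBWithoutOrdinary :=
  fun W _ _ p _ _ _ _ => h W p

theorem withoutGood_of_everywhere (h : UBEverywhere) : UBWithoutGood :=
  fun W _ _ p _ _ _ _ => h W p

theorem withoutFive_of_everywhere (h : UBEverywhere) : UBWithoutFive :=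
  fun W _ _ p _ _ _ _ => h W p

theorem selmerRankUB_of_withoutSurjective (h : UBWithoutSurjective) : SelmerRankUB :=
  fun W _ _ p _ h5 hg ho _ => h W p h5 hg ho

theorem selmerRankUB_of_withoutOrdinary (h : UBWithoutOrdinary) : SelmerRankUB :=
  fun W _ _ p _ h5 hg _ hs => h W p h5 hg hs

theorem selmerRankUB_of_withoutGood (h : UBWithoutGood) : SelmerRankUB :=
  fun W _ _ p _ h5 _ ho hs => h W p h5 ho hs

theorem selmerRankUB_of_withoutFive (h : UBWithoutFive) : SelmerRankUB :=
  fun W _ _ p _ _ hg ho hs => h W p hg ho hs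

/-- **The strongest mutation is still a consequence of the standard conjectures** (r1, imported):
BSD-rank ∧ `SelmerRankShaPFinite` (stmt-0132) give `UBEverywhere`. [folklore] -/
theorem everywhere_of_bsd_shaFinite (hS : _root_.BirchSwinnertonDyer)
    (hSha : SelmerRank.SelmerRankShaPFinite) : UBEverywhere :=
  fun W _ p _ => CruxAttack.ub_everywhere_of_summit_of_shaFinite hS hSha W p

/-- **No `_false_without_<H>` theorem can exist short of ¬BSD or a divisible Ш**: a refutation of
ANY of the four weakened-hypothesis variants (or of the hypothesis-free one) refutes
`BirchSwinnertonDyer ∧ SelmerRankShaPFinite`. This is why §2 contains no witness. [folklore] -/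
theorem no_false_without_of_bsd_shaFinite (hS : _root_.BirchSwinnertonDyer)
    (hSha : SelmerRank.SelmerRankShaPFinite) :
    UBWithoutSurjective ∧ UBWithoutOrdinary ∧ UBWithoutGood ∧ UBWithoutFive ∧ UBEverywhere :=
  ⟨withoutSurjective_of_everywhere (everywhere_of_bsd_shaFinite hS hSha),
    withoutOrdinary_of_everywhere (everywhere_of_bsd_shaFinite hS hSha),
    withoutGood_of_everywhere (everywhere_of_bsd_shaFinite hS hSha),
    withoutFive_of_everywhere (everywhere_of_bsd_shaFinite hS hSha),
    everywhere_of_bsd_shaFinite hS hSha⟩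

/-- The UB-half of the sibling item `SelmerRankSmallImage` (stmt-14418): the non-surjective
sector. [folklore] -/
def SmallImageUBHalf : Prop :=
  ∀ (W : WeierstrassCurve ℚ) [W.IsElliptic] [W.IsGloballyMinimal] (p : ℕ) [Fact p.Prime],
    5 ≤ p → W.HasGoodReductionAtPrime p → ¬ (p : ℤ) ∣ W.frobeniusTrace p →
      ¬ W.HasSurjectiveModNGaloisRep p → W.selmerCorank p ≤ W.analyticRank

/-- **What dropping `surjective` costs, exactly**: the image-free variant is the crux together
with the UB-half of the sibling `SelmerRankSmallImage` — an item the routes already carry.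
[folklore] -/
theorem withoutSurjective_iff : UBWithoutSurjective ↔ SelmerRankUB ∧ SmallImageUBHalf := by
  constructor
  · exact fun h => ⟨selmerRankUB_of_withoutSurjective h, fun W _ _ p _ h5 hg ho _ => h W p h5 hg ho⟩
  · rintro ⟨hUB, hSI⟩ W _ _ p _ h5 hg ho
    by_cases hs : W.HasSurjectiveModNGaloisRep p
    · exact hUB W p h5 hg ho hs
    · exact hSI W p h5 hg ho hs

theorem smallImageUBHalf_of_smallImage (h : ShadowIsolation.SelmerRankSmallImage) :
    SmallImageUBHalf :=
  fun W _ _ p _ h5 hg ho hs => (h W p h5 hg ho hs).le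

/-! ## §3 Parity filter (modulo the `p`-parity fact, Dokchitser–Dokchitser 2010 Thm 1.4) -/

/-- **A counterexample overshoots by at least two.** Modulo `selmerCorank_mod_two_eq W p`
(`corank_p ≡ r_an (mod 2)`, bsd.S19), a failure of `corank_p ≤ r_an` forces `r_an + 2 ≤ corank_p`.
[cite: DokchitserDokchitserAnnals2010, Thm. 1.4] -/
theorem gap_two_of_parity (W : WeierstrassCurve ℚ) (p : ℕ) (hpar : selmerCorank_mod_two_eq W p)
    (h : ¬ W.selmerCorank p ≤ W.analyticRank) : W.analyticRank + 2 ≤ W.selmerCorank p := by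
  unfold selmerCorank_mod_two_eq at hpar
  omega

/-- Equivalently: modulo `p`-parity the crux at `(W, p)` is the same as the a priori weaker
`corank_p ≤ r_an + 1`. [cite: DokchitserDokchitserAnnals2010, Thm. 1.4] -/
theorem ub_iff_ub_add_one_of_parity (W : WeierstrassCurve ℚ) (p : ℕ)
    (hpar : selmerCorank_mod_two_eq W p) :
    W.selmerCorank p ≤ W.analyticRank ↔ W.selmerCorank p ≤ W.analyticRank + 1 := by
  unfold selmerCorank_mod_two_eq at hpar
  omega

/-! ## §4 First open cell (modulo Gross–Zagier–Kolyvagin) -/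

/-- **Every counterexample has analytic rank ≥ 2** (modulo the GZK fact bsd.S17: `r_an ≤ 1 ⇒
rank = r_an ∧ Ш finite`, with Greenberg's identity — tree theorem
`selmerCorank_eq_analyticRank_of_analyticRank_le_one`). [cite: Darmon2004, Thm. 3.22] -/
theorem two_le_analyticRank_of_counterexample
    (hGZK : rank_eq_analyticRank_of_analyticRank_le_one) (W : WeierstrassCurve ℚ) [W.IsElliptic]
    (p : ℕ) [Fact p.Prime] (h : ¬ W.selmerCorank p ≤ W.analyticRank) : 2 ≤ W.analyticRank := by
  by_contra hlt
  push Not at hlt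
  have heq := selmerCorank_eq_analyticRank_of_analyticRank_le_one hGZK W p (by omega)
  omega

/-- **… and Selmer corank ≥ 4** (GZK + `p`-parity): the first open cell of the crux is
`corank_p Sel_{p^∞} = 4` against `r_an = 2`. [cite: DokchitserDokchitserAnnals2010, Thm. 1.4] -/
theorem four_le_selmerCorank_of_counterexample
    (hGZK : rank_eq_analyticRank_of_analyticRank_le_one) (W : WeierstrassCurve ℚ) [W.IsElliptic]
    (p : ℕ) [Fact p.Prime] (hpar : selmerCorank_mod_two_eq W p)
    (h : ¬ W.selmerCorank p ≤ W.analyticRank) : 4 ≤ W.selmerCorank p := by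
  have h2 := two_le_analyticRank_of_counterexample hGZK W p h
  have h3 := gap_two_of_parity W p hpar h
  omega

/-- **Profile of a minimal counterexample** (modulo GZK and `p`-parity): a NON-CM curve with a
big-image good ordinary `p ≥ 5`, `r_an ≥ 2`, `rank + corank Ш[p^∞] ≥ r_an + 2`, `corank_p ≥ 4`.
[cite: DokchitserDokchitserAnnals2010, Thm. 1.4] -/
theorem counterexample_profile (hGZK : rank_eq_analyticRank_of_analyticRank_le_one)
    (hpar : ∀ (W : WeierstrassCurve ℚ) [W.IsElliptic] (p : ℕ) [Fact p.Prime],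
      selmerCorank_mod_two_eq W p)
    (h : ¬ SelmerRankUB) :
    ∃ (W : WeierstrassCurve ℚ) (_ : W.IsElliptic) (_ : W.IsGloballyMinimal) (p : ℕ)
      (_ : Fact p.Prime), 5 ≤ p ∧ W.HasGoodReductionAtPrime p ∧ ¬ (p : ℤ) ∣ W.frobeniusTrace p ∧
        W.HasSurjectiveModNGaloisRep p ∧ ¬ W.HasCM ∧ 2 ≤ W.analyticRank ∧
          W.analyticRank + 2 ≤ W.mordellWeilRank + W.shaCorank p ∧ 4 ≤ W.selmerCorank p := by
  obtain ⟨W, _, _, p, _, h5, hg, ho, hs, hlt⟩ := not_selmerRankUB_iff.mp h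
  have hid : W.selmerCorank p = W.mordellWeilRank + W.shaCorank p :=
    W.selmerCorank_eq_mordellWeilRank_add_holds p
  have hfail : ¬ W.selmerCorank p ≤ W.analyticRank := by omega
  refine ⟨W, inferInstance, inferInstance, p, inferInstance, h5, hg, ho, hs,
    not_hasCM_of_hasSurjectiveModNGaloisRep_of_five_le W p h5 hg ho hs,
    two_le_analyticRank_of_counterexample hGZK W p hfail, ?_,
    four_le_selmerCorank_of_counterexample hGZK W p (hpar W p) hfail⟩
  have := gap_two_of_parity W p (hpar W p) hfail
  omega

/-! ## §5 Scope: the crux binds no CM curve -/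

/-- **The crux is silent on CM curves**: restricting it to non-CM `W` changes nothing, because a
curve with a surjective `ρ̄_{E,p}` at a good ordinary `p ≥ 5` has no CM (tree theorem, Serre 1972
§4.5). The CM sector is the sibling item `SelmerRankCM`. [cite: Serre1972, §4.5] -/
theorem selmerRankUB_iff_nonCM :
    SelmerRankUB ↔
      ∀ (W : WeierstrassCurve ℚ) [W.IsElliptic] [W.IsGloballyMinimal] (p : ℕ) [Fact p.Prime],
        ¬ W.HasCM → 5 ≤ p → W.HasGoodReductionAtPrime p → ¬ (p : ℤ) ∣ W.frobeniusTrace p →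
          W.HasSurjectiveModNGaloisRep p → W.selmerCorank p ≤ W.analyticRank :=
  ⟨fun h W _ _ p _ _ h5 hg ho hs => h W p h5 hg ho hs, fun h W _ _ p _ h5 hg ho hs =>
    h W p (not_hasCM_of_hasSurjectiveModNGaloisRep_of_five_le W p h5 hg ho hs) h5 hg ho hs⟩

/-! ## §6 Tightness -/

/-- **The bound is attained wherever `r_an ≤ 1`** (modulo GZK): `corank_p = r_an`, so the
inequality of the crux is sharp — no `<`, no shaved constant. [cite: Darmon2004, Thm. 3.22] -/
theorem tight_of_gzk (hGZK : rank_eq_analyticRank_of_analyticRank_le_one) (W : WeierstrassCurve ℚ)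
    [W.IsElliptic] (p : ℕ) [Fact p.Prime] (h : W.analyticRank ≤ 1) :
    W.selmerCorank p = W.analyticRank :=
  selmerCorank_eq_analyticRank_of_analyticRank_le_one hGZK W p h

/-- The STRICT strengthening of the crux (a natural over-reach). [folklore] -/
def SelmerRankUBStrict : Prop :=
  ∀ (W : WeierstrassCurve ℚ) [W.IsElliptic] [W.IsGloballyMinimal] (p : ℕ) [Fact p.Prime],
    5 ≤ p → W.HasGoodReductionAtPrime p → ¬ (p : ℤ) ∣ W.frobeniusTrace p →
      W.HasSurjectiveModNGaloisRep p → W.selmerCorank p < W.analyticRank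

/-- **The strict strengthening dies on any instance of analytic rank `0`** (e.g. `X₀(11)` at
`p = 7`: `a_7 = −2`, `ρ̄_{E,7}` surjective, `L(E,1)/Ω ≈ 0.2538 ≠ 0`). NEAR-MISS: the instance is not
constructible in the tree today — `analyticRank = 0` for a named curve needs a certified central
value of the entire continuation (modularity is Statement-borne cone debt,
`hasEntireLFunction_rat`), so the refutation of the strengthening is recorded modulo the instance.
[folklore] -/
theorem strict_false_of_rankZero_instance
    (hinst : ∃ (W : WeierstrassCurve ℚ) (_ : W.IsElliptic) (_ : W.IsGloballyMinimal) (p : ℕ)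
      (_ : Fact p.Prime), 5 ≤ p ∧ W.HasGoodReductionAtPrime p ∧ ¬ (p : ℤ) ∣ W.frobeniusTrace p ∧
        W.HasSurjectiveModNGaloisRep p ∧ W.analyticRank = 0) :
    ¬ SelmerRankUBStrict := by
  rintro h
  obtain ⟨W, _, _, p, _, h5, hg, ho, hs, h0⟩ := hinst
  have := h W p h5 hg ho hs
  omega

/-! ## §7 What the crux gives back: Ш-cotorsion from one-sided rank information -/

/-- **UB + "no deficient rank" = Ш-cotorsion.** If `r_an ≤ rank` at the instance (the LB
rank-half — certified curve-by-curve in every table, and a theorem for `r_an ≤ 1`), the crux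
yields `corank_{ℤ_p} Ш[p^∞] = 0` there. Sharpens r1's `shaCotorsion_of_summit_of_ub` (full summit).
[cite: GreenbergLNM1716, §1] -/
theorem shaCotorsion_of_ub_of_noDeficientRank (hUB : SelmerRankUB) (W : WeierstrassCurve ℚ)
    [W.IsElliptic] [W.IsGloballyMinimal] (p : ℕ) [Fact p.Prime] (h5 : 5 ≤ p)
    (hg : W.HasGoodReductionAtPrime p) (ho : ¬ (p : ℤ) ∣ W.frobeniusTrace p)
    (hs : W.HasSurjectiveModNGaloisRep p) (hLB : W.analyticRank ≤ W.mordellWeilRank) :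
    W.shaCorank p = 0 ∧ W.mordellWeilRank = W.analyticRank := by
  have h1 := hUB W p h5 hg ho hs
  have h2 : W.selmerCorank p = W.mordellWeilRank + W.shaCorank p :=
    W.selmerCorank_eq_mordellWeilRank_add_holds p
  omega

/-! ## §8 Line `greenberg-split`: the stubs (targets) -/

section Line

open GreenbergSplit

/-- **Target `stub_noExcessRankBigImage` is not refutable short of ¬BSD**: it is implied by the
summit outright (r1 `rankUB_of_summit`, forgetting `2 ≤ r_an`). [folklore] -/
theorem stub_noExcess_of_bsd (hS : _root_.BirchSwinnertonDyer) :
    Statement.stub_noExcessRankBigImage :=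
  fun W _ _ p _ h5 hg ho hs _ => CruxAttack.rankUB_of_summit hS W p h5 hg ho hs

/-- **Target `stub_shaCotorsionBigImage` is not refutable short of a divisible Ш** (skeleton's
`shaCotorsionBigImage_of_shaPFinite`, restated for the record). [folklore] -/
theorem stub_sha_of_shaPFinite (hSha : SelmerRank.SelmerRankShaPFinite) :
    Statement.stub_shaCotorsionBigImage :=
  shaCotorsionBigImage_of_shaPFinite hSha

/-- **No hypothesis of `stub_noExcessRankBigImage` is load-bearing for truth**: dropping all four
prime hypotheses AND `2 ≤ r_an` gives verbatim the sibling item `Squeeze.SqueezeUB`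
(`∀ W elliptic, rank ≤ r_an`), itself summit-implied. [folklore] -/
theorem stub_noExcess_withoutHyps_of_squeezeUB (h : Squeeze.SqueezeUB) :
    ∀ (W : WeierstrassCurve ℚ) [W.IsElliptic], W.mordellWeilRank ≤ W.analyticRank :=
  fun W _ => h W

theorem squeezeUB_of_bsd (hS : _root_.BirchSwinnertonDyer) : Squeeze.SqueezeUB :=
  fun W hW => (hS W hW).ge

/-- The GZK cell UNDER THE CRUX BINDERS — all the composition `SelmerRankUB_of` consumes from
`stub_gzkSelmerCell` (which is image-free and prime-free, hence more than needed). [folklore] -/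
def GZKCellBigImage : Prop :=
  ∀ (W : WeierstrassCurve ℚ) [W.IsElliptic] [W.IsGloballyMinimal] (p : ℕ) [Fact p.Prime],
    5 ≤ p → W.HasGoodReductionAtPrime p → ¬ (p : ℤ) ∣ W.frobeniusTrace p →
      W.HasSurjectiveModNGaloisRep p → W.analyticRank ≤ 1 → W.selmerCorank p ≤ W.analyticRank

theorem gzkCellBigImage_of_stub (h : Statement.stub_gzkSelmerCell) : GZKCellBigImage :=
  fun W _ _ p _ _ _ _ _ h1 => h W p h1

/-- The restricted cell is returned by the crux itself (it is the crux on `r_an ≤ 1`). [folklore] -/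
theorem gzkCellBigImage_of_selmerRankUB (h : SelmerRankUB) : GZKCellBigImage :=
  fun W _ _ p _ h5 hg ho hs _ => h W p h5 hg ho hs

/-- **Composition with the restricted cell** (same proof as the skeleton's `SelmerRankUB_of`).
[cite: GreenbergLNM1716, §1] -/
theorem selmerRankUB_of_cells (hGZK : GZKCellBigImage)
    (hRank : Statement.stub_noExcessRankBigImage) (hSha : Statement.stub_shaCotorsionBigImage) :
    SelmerRankUB := by
  intro W _ _ p _ h5 hgood hord hsurj
  by_cases h1 : W.analyticRank ≤ 1
  · exact hGZK W p h5 hgood hord hsurj h1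
  · have h2 : 2 ≤ W.analyticRank := by omega
    rw [W.selmerCorank_eq_mordellWeilRank_add_holds p, hSha W p h5 hgood hord hsurj h2, add_zero]
    exact hRank W p h5 hgood hord hsurj h2

/-- **Exactness modulo the Ш-half ALONE**: the crux ⇔ (its own `r_an ≤ 1` cell) ∧ (no excess rank
in `r_an ≥ 2`). The skeleton's `selmerRankUB_iff_noExcess` needed the GZK stub as well; here the
cell is on the right-hand side, so nothing but the Ш-half is assumed. [cite: GreenbergLNM1716, §1] -/
theorem selmerRankUB_iff_cells (hSha : Statement.stub_shaCotorsionBigImage) :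
    SelmerRankUB ↔ GZKCellBigImage ∧ Statement.stub_noExcessRankBigImage :=
  ⟨fun h => ⟨gzkCellBigImage_of_selmerRankUB h, noExcessRankBigImage_of_selmerRankUB h⟩,
    fun h => selmerRankUB_of_cells h.1 h.2 hSha⟩

/-- **Joint sufficiency has no gap**: the skeleton's composition, re-used verbatim (imported). If a
stub were misstated too weakly this `example` would not typecheck. [folklore] -/
example (hGZK : Statement.stub_gzkSelmerCell) (hRank : Statement.stub_noExcessRankBigImage)
    (hSha : Statement.stub_shaCotorsionBigImage) : SelmerRankUB :=
  SelmerRankUB_of hGZK hRank hSha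

/-- **All three targets at once are consequences of BSD ∧ Ш-finite ∧ GZK** — so the line cannot
be broken by a stub refutation unless a standard conjecture (or the GZK theorem in print) falls.
[folklore] -/
theorem stubs_of_standard_conjectures (hS : _root_.BirchSwinnertonDyer)
    (hSha : SelmerRank.SelmerRankShaPFinite)
    (hGZK : rank_eq_analyticRank_of_analyticRank_le_one) :
    Statement.stub_gzkSelmerCell ∧ Statement.stub_noExcessRankBigImage ∧
      Statement.stub_shaCotorsionBigImage :=
  ⟨gzkSelmerCell_of_fact hGZK, stub_noExcess_of_bsd hS, stub_sha_of_shaPFinite hSha⟩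

end Line

/-!
## -- Compute (cheapest falsifier, cycle 1)

The only certifiable witness shape (§4) is a curve with ≥ 4 independent points, `w = +1`,
`L(E,1) = 0` and `L''(E,1) ≠ 0` (odd analogue: ≥ 5 points, `w = -1`, `L'''(E,1) ≠ 0`).
Kit job `j026907` (PARI/GP 2.15.4, `cexscan2.gp` in the seat folder, one batch, single-threaded
`ellL1`, realprecision 28, wall 276 s; the first attempt `j026679` hung at 0 CPU in the
multithreaded `lfun` engine and timed out with no table) tabulated, for the rank-record curves of
ranks 2–7, the conductor, root number, torsion, the 2-descent rank certificate `ellrank`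
(lower = upper = number of independent points found), `a_p` at the good `p ∈ [5,60]`, and the
central Taylor coefficients `c_j = L^{(j)}(E,1)/j!`, `0 ≤ j ≤ rank`:

| curve `[a₁,a₂,a₃,a₄,a₆]` | `N` | `w` | `ellrank` | `a₅` | `max_{j<rank} |c_j|` | `c_rank` |
|---|---|---|---|---|---|---|
| 389a1 `[0,1,1,-2,0]` | 389 | +1 | [2,2] | −3 | `1.7·10⁻³⁹` | `0.75932` |
| 5077a1 `[0,0,1,-7,6]` | 5077 | −1 | [3,3] | −4 | `6.6·10⁻³⁹` | `1.73185` |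
| 234446a1 `[1,-1,0,-79,289]` | 2·117223 | +1 | [4,4] | −4 | `3.5·10⁻³⁷` | `8.94385` |
| 19047851a1 `[0,0,1,-79,342]` | 19047851 (prime) | −1 | [5,5] | −3 | `1.1·10⁻³⁶` | `30.2857` |
| EW6 `[1,1,0,-2582,48720]` | 2·3·2777·311341 | +1 | [6,6] | −4 | `8.9·10⁻³⁶` | `320.781` |
| EW7 `[0,0,0,-10012,346900]` | 2³·47827988557 | −1 | [7,7] | −4 | `1.8·10⁻³⁴` | `1325.17` |

(`ellanalyticrank` agrees: 2, 3, 4, 5, 6, 7.) Reading: on every record curve the first `rank`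
Taylor coefficients vanish to working precision and the `rank`-th is of order 1–10³, i.e.
numerically `r_an = rank`, parity `w = (-1)^rank` as forced by §3, and `p = 5` is a good ordinary
prime of each (`a₅ ∈ {-3,-4}`), so each curve does fall under the crux's hypothesis block at
`p = 5` granted mod-5 surjectivity (not computed here). NO WITNESS: a kill needs `c_j ≠ 0` for
some `j ≤ rank - 2`, and the smallest such `|c_j|` that would have to be "really nonzero" is below
`2·10⁻³⁴`. As announced, numerics can never certify the vanishing side, so this scan can only ever
SUPPORT the crux or kill it, never settle it; it supports it on the whole known record range in
which `L^{(j)}(E,1)` is computable in minutes (rank ≤ 7, `N ≤ 3.9·10¹¹`).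
-/

end Summit.BirchSwinnertonDyer.BirchSwinnertonDyer.Cruxes.SelmerRankUB.Disproof
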